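import Literature.MathematicalPhysics.QuantumFieldTheory.Balaban1983to89.B9Eq387IMSLocalLettersLattice
import Literature.MathematicalPhysics.QuantumFieldTheory.Balaban1983to89.B9Eq319QprimeTorus

/-!
# `Balaban1983to89.B9Eq349BlockDistanceWeight` — T. Bałaban, *Propagators for lattice gauge theories in a background field*, Commun. Math. Phys.
# **99** (1985) 389–434 [Balaban1985BackgroundPropagators] (3.49) p. 399 («e^{−δ₀d(y,y′)} for x ∈ Δ(y), x′ ∈ Δ(y′)») with (3.101) p. 414, over the block
# geometry of [Balaban1985Averaging] (2) p. 17: **THE PAIR-ADAPTED CONJUGATION WEIGHT ON THE FINE TORUS — for two `L`-blocks `Δ(y₀)`, `Δ(y₁)` of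
# `T_{(L·m)}` the weight `w = min(dist(·, Δ(y₀)), D)`, `D = (L·d_m(y₀,y₁) − (L−1))₊`, is `≡ 0` on `Δ(y₀)`, `≡ D` on `Δ(y₁)`, `1`-Lipschitz across every
# bond and oscillates by `≤ L − 1` inside a block; `χ := w∕L` has bond increments `≤ 1∕L`, block oscillation `≤ 1`, and `D∕L ≥ d_m(y₀,y₁) − 1`** (with
# the fine ↔ coarse comparison `L·d_m(π x, π x′) − (L−1) ≤ d_{Lm}(x,x′) ≤ L·d_m(π x, π x′) + (L−1)`) — route R2′ STEP B8′ of the pub-balaban NE9 chain,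
# instance-ledger row L9 (`k_W`), brick (K2): the weight that turns ONE real conjugation bound into the block entry `τ_{y₁y₀} = C·e^{−r(d_m(y₀,y₁) − 1)}`

statement-level skeleton of published theorems with citation tags; proofs where landed; nothing here is a claim about the Yang–Mills mass gap

CITATION HEADER (lean-in-tree rule).  Audit cell `pub-balaban`, sub-cell `t4`, BINDER row NE9; filed by NE9 formalisation-swarm LEAF PROVER 01
(`b2b-balaban-t4-ne9-formalise-leaf-01`, gen 83), the lineage of the glue (A) `B9Eq3101CommutatorCauchyBlockDecay` (whose §2
`norm_block_le_of_conj_bound_abs` consumes a weight CONSTANT on the source block (`a`) and on the target block (`b`) and ONE conjugation bound at `±κ₀`)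
and (B) `B9Eq3101DoubleCommutatorBlockSchur`; announced 2026-08-23 [NE9LEAF01-G83-ONLINE] as (K2).  The torus distance `tdist`, the set distance
`tsetDist` and their Lipschitz∕triangle facts are the cell's `B4Sect5Torus` §8–§9 (paper sub-cell b04∕pv23), the blocks `blockOf`∕`blockCoord`∕`centre` are
`B9Eq319QprimeTorus` §1 (sub-cell b09∕b07), the bond step `circAbs_bond_le_one` is this lineage's (D) `B9Eq387IMSLocalLettersLattice` §4 — all BY NAME.
Source READ in the held text [Balaban1985BackgroundPropagators] (journal page = PDF page + 388): p. 399 (3.49) *«≤ O(1)[…]e^{−δ₀d(y,y′)} for x ∈ Δ(y),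
y ∈ Λ_j, x′ ∈ Δ(y′), y′ ∈ Λ_{j′}»* (decay in the COARSE distance of the blocks containing the two arguments); [Balaban1985Averaging] p. 17 (2) *«B(y) =
{x ∈ T_η : y_μ ≦ x_μ < y_μ + L^kη}»*.  Print obtains (3.49) from random-walk expansions; the route (ROUTES-NE9 §L1.2 R2′ STEP B8′, row L9) obtains block decay
from a Combes–Thomas conjugation by a PAIR-ADAPTED weight — this file supplies that weight; NOTHING of print's estimate is asserted.

WHY (row L9).  (A) §2 needs, per block pair, a weight `χ` with `χ_S∘p_{y₀} = a•p_{y₀}`, `q_{y₁}∘χ_E = b•q_{y₁}` ((K1) `B9Eq349BlockMultipliers.mul_comp_block_eq_smul`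
∕ `block_comp_mul_eq_smul` from `χ ≡ a` on `Δ(y₀)`, `χ ≡ b` on `Δ(y₁)`), and ne9-leaf-06's circle letter `B9Eq349ConjugatedDPCircle.norm_conjFamily_le_of_circle`
needs of the SAME `χ`: bond increments `|χ(b₋) − χ(b₊)| ≤ ℓη` (`hχ`), a coarse reading `|χ′(y) − χ(x)| ≤ ℓ′` on `Δ(y)` (`hχ′`) and the in-block oscillation
`|χ(b₋) − χ(x)| ≤ ω` (`hω`) — its bound `C(r)` then holds at every `κ` with `‖κ‖ = r`, in particular at the two real points `±r`, and (A) §2 delivers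
`‖q_{y₁}(D_UP(U))p_{y₀}‖ ≤ e^{−r(b−a)}·C(r)` with `b − a = D∕L ≥ d_m(y₀,y₁) − 1`: the entry letter `τ` of (B) with the rate `r` per COARSE step.

WHAT IS PROVED (sorry-free; proof lane — no `def`; [folklore] integer arithmetic of `circAbs` and finite `min`∕`inf`; `1 ≤ L`, `1 ≤ m_i`).
* §1 ONE CIRCLE: **`mul_circAbs_sub_le_circAbs`** (`L·dist(q − q′, mℤ) − (L−1) ≤ dist(Lq + r − (Lq′ + r′), Lmℤ)` for offsets `0 ≤ r, r′ ≤ L−1`) and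
  **`circAbs_le_mul_circAbs_add`** (`… ≤ L·dist(q − q′, mℤ) + (L−1)`) — by the centring representatives `B4TorusKernel.MultiPeriod.abs_add_mul_centre`.
* §2 THE TORUS: `exists_tdist_eq_circAbs` (the sup is attained, `0 < d`), `tdist_le_of_forall_le`; **`mul_tdist_blockCoord_sub_le_tdist`**
  (`L·d_m(π x, π x′) − (L−1) ≤ d_{Lm}(x, x′)`), **`tdist_le_mul_tdist_blockCoord_add`** (`d_{Lm}(x,x′) ≤ L·d_m(π x, π x′) + (L−1)`),
  `tdist_le_of_blockCoord_eq` (same block ⇒ `≤ L−1`), `tdist_shift_le_one` ∕ **`tdist_bpos_btgt_le_one`** (a bond has length `≤ 1`).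
* §3 THE SET DISTANCE TO A BLOCK: `tsetDist_blockOf_eq_zero` (on the block), `abs_tsetDist_sub_le_tdist` (1-Lipschitz), **`le_tsetDist_blockOf`**
  (`L·d_m(y₀, π x) − (L−1) ≤ dist(x, Δ(y₀))`).
* §4 THE TRUNCATED WEIGHT `w = min(dist(·, Δ(y₀)), D)`: **`truncDist_eq_zero_of_mem`**, **`truncDist_eq_of_mem`** (`≡ D` on `Δ(y₁)` for
  `D = (L·d_m(y₀,y₁) − (L−1))₊`), `abs_truncDist_sub_le_tdist`, `abs_truncDist_bond_le_one`, `abs_truncDist_sub_le_of_blockCoord_eq` (`≤ L−1`), `truncDist_nonneg`.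
* §5 THE PACKAGE in ne9-leaf-06's letters: **`exists_pairWeight`** — for every pair `(y₀, y₁)` of coarse sites there is `χ : TSite d (fineP L m) → ℝ`, `0 ≤ χ`,
  `χ ≡ 0` on `Δ(y₀)`, `χ ≡ D∕L` on `Δ(y₁)`, `|χ(b₋) − χ(b₊)| ≤ 1∕L` (every bond), `|χ x − χ x′| ≤ 1` (same block), `|χ(L·y) − χ x| ≤ 1` on `Δ(y)` (the coarse
  reading at the centres), and `d_m(y₀,y₁) − 1 ≤ D∕L ≤ d_m(y₀,y₁)`.  §6 non-vacuity (`L = 1`-free numeric instance of §1).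
HONEST SCOPE.  Lattice geometry only; no operator, no exponential, no estimate of the paper; brick (K2) of four for ONE letter (`k_W`, row L9) of ONE sub-step
of a route step, NOT NE9 (cell pub-balaban: NE9 NOT PRINTED ∕ NOT PROVED; «NE9 ⇐ the named binders»; row WALLED ON A MODEL (O-NE9-1); spine PROVED 0∕9; rung
(B)+1 on a finite T⁴ — NOT infinite volume, NOT mass gap, NOT Clay; HONEST DEPENDENCY: continuum YM on T⁴ ⇐ BetaPertH ∧ nine spine estimates (0/9 proved);
BetaPertH ⇐ (D1) ∧ (D4) ∧ CAP+tail; G-an2-4 gates asym, D1 and NE2/3/4).  NEW file importing (D) `B9Eq387IMSLocalLettersLattice` (for `circAbs_bond_le_one`;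
⊇ `B4Sect5Torus`, `B9SectCLatticeCarrier`) and `B9Eq319QprimeTorus`; nothing modified.  Net new unproved facts: 0.
-/

noncomputable section

namespace Literature.MathematicalPhysics.QuantumFieldTheory.Balaban1983to89.B9Eq349BlockDistanceWeight

open B4TorusKernel.MultiPeriod (circAbs circAbs_nonneg circAbs_le_abs circAbs_add_mul abs_add_mul_centre)
open B4Sect5Torus (TSite ccoord tdist tdist_symm tdist_self tdist_triangle tdist_nonneg circAbs_le_tdist ccoord_cast circAbs_zero tsetDist
  tsetDist_nonneg tsetDist_le_of_mem tsetDist_le_tdist_add)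
open B9SectCLatticeCarrier (Bond bpos btgt shift shift_apply_val shift_apply_ne)
open B9Eq319QprimeTorus (fineP blockCoord mem_blockOf_iff centre_mem_blockOf blockCoord_centre blockCoord_apply_val centre_apply_val)
open B9Eq387IMSLocalLettersLattice (circAbs_bond_le_one)

/-! ## §1 One circle: the fine circular distance against the coarse one -/

section Circle

/-- **`L·dist(q − q′, mℤ) − (L − 1) ≤ dist(Lq + r − (Lq′ + r′), Lmℤ)`** for offsets `0 ≤ r, r′ ≤ L − 1`: the fine circular distance of two points dominates
`L` times the coarse circular distance of their blocks, up to one block width. [folklore] [cite: Balaban1985Averaging, (2) p.17; Balaban1985BackgroundPropagators, (3.49) p.399] -/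
theorem mul_circAbs_sub_le_circAbs {L m : ℕ} (hL : 1 ≤ L) (hm : 1 ≤ m) (q q' r r' : ℤ) (hr : 0 ≤ r) (hrL : r ≤ L - 1) (hr' : 0 ≤ r')
    (hr'L : r' ≤ L - 1) :
    (L : ℤ) * circAbs m (q - q') - ((L : ℤ) - 1) ≤ circAbs (L * m) (L * q + r - (L * q' + r')) := by
  have hLm : 1 ≤ L * m := Nat.one_le_iff_ne_zero.mpr (Nat.mul_ne_zero (by omega) (by omega))
  set z : ℤ := L * q + r - (L * q' + r') with hz
  set c : ℤ := B4TorusKernel.MultiPeriod.centre (L * m) z with hc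
  have h1 : circAbs (L * m) z = |z + (L * m : ℕ) * c| := (abs_add_mul_centre hLm z).symm
  have h2 : circAbs m (q - q') ≤ |q - q' + m * c| := by
    rw [← circAbs_add_mul m (q - q') c]
    exact circAbs_le_abs hm _
  have h3 : z + (L * m : ℕ) * c = L * (q - q' + m * c) + (r - r') := by rw [hz]; push_cast; ring
  have h4 : |(L : ℤ) * (q - q' + m * c)| ≤ |z + (L * m : ℕ) * c| + |r - r'| := by
    have := abs_sub (z + (L * m : ℕ) * c) (r - r')
    rw [show z + (L * m : ℕ) * c - (r - r') = L * (q - q' + m * c) by rw [h3]; ring] at this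
    exact this
  have h5 : |r - r'| ≤ (L : ℤ) - 1 := by rw [abs_le]; constructor <;> omega
  have hL0 : (0 : ℤ) ≤ L := by positivity
  rw [h1]
  rw [abs_mul, abs_of_nonneg hL0] at h4
  nlinarith [mul_le_mul_of_nonneg_left h2 hL0]

/-- **`dist(Lq + r − (Lq′ + r′), Lmℤ) ≤ L·dist(q − q′, mℤ) + (L − 1)`** for offsets `0 ≤ r, r′ ≤ L − 1`. [folklore]
[cite: Balaban1985Averaging, (2) p.17; Balaban1985BackgroundPropagators, (3.49) p.399] -/
theorem circAbs_le_mul_circAbs_add {L m : ℕ} (hL : 1 ≤ L) (hm : 1 ≤ m) (q q' r r' : ℤ) (hr : 0 ≤ r) (hrL : r ≤ L - 1) (hr' : 0 ≤ r')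
    (hr'L : r' ≤ L - 1) :
    circAbs (L * m) (L * q + r - (L * q' + r')) ≤ (L : ℤ) * circAbs m (q - q') + ((L : ℤ) - 1) := by
  have hLm : 1 ≤ L * m := Nat.one_le_iff_ne_zero.mpr (Nat.mul_ne_zero (by omega) (by omega))
  set z : ℤ := L * q + r - (L * q' + r') with hz
  set c : ℤ := B4TorusKernel.MultiPeriod.centre m (q - q') with hc
  have h1 : circAbs m (q - q') = |q - q' + m * c| := (abs_add_mul_centre hm _).symm
  have h2 : circAbs (L * m) z ≤ |z + (L * m : ℕ) * c| := by
    rw [← circAbs_add_mul (L * m) z c]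
    exact circAbs_le_abs hLm _
  have h3 : z + (L * m : ℕ) * c = L * (q - q' + m * c) + (r - r') := by rw [hz]; push_cast; ring
  have h4 : |z + (L * m : ℕ) * c| ≤ |(L : ℤ) * (q - q' + m * c)| + |r - r'| := by rw [h3]; exact abs_add_le _ _
  have h5 : |r - r'| ≤ (L : ℤ) - 1 := by rw [abs_le]; constructor <;> omega
  have hL0 : (0 : ℤ) ≤ L := by positivity
  rw [abs_mul, abs_of_nonneg hL0, ← h1] at h4
  linarith

end Circle

/-! ## §2 The torus: fine sup-distance against the coarse sup-distance of the block coordinates -/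

section Torus

variable {d : ℕ}

/-- the sup is attained: for `0 < d` some coordinate realises `tdist`. [folklore] [cite: Balaban1985BackgroundPropagators, (3.49) p.399] -/
theorem exists_tdist_eq_circAbs {P : Fin d → ℕ} (hP : ∀ i, 1 ≤ P i) (hd : 0 < d) (x y : TSite d P) :
    ∃ i : Fin d, tdist P x y = (circAbs (P i) (((x i).val : ℤ) - ((y i).val : ℤ)) : ℝ) := by
  have hne : (Finset.univ : Finset (Fin d)).Nonempty := ⟨⟨0, hd⟩, Finset.mem_univ _⟩
  obtain ⟨i, -, hi⟩ := Finset.exists_mem_eq_sup Finset.univ hne (ccoord P x y)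
  refine ⟨i, ?_⟩
  unfold tdist
  rw [hi]
  have := ccoord_cast hP x y i
  exact_mod_cast this

/-- an upper bound on every coordinate distance bounds `tdist` (`0 ≤ C` covers `d = 0`). [folklore] [cite: Balaban1985BackgroundPropagators, (3.49) p.399] -/
theorem tdist_le_of_forall_le {P : Fin d → ℕ} (hP : ∀ i, 1 ≤ P i) (x y : TSite d P) {C : ℝ} (hC : 0 ≤ C)
    (h : ∀ i, (circAbs (P i) (((x i).val : ℤ) - ((y i).val : ℤ)) : ℝ) ≤ C) : tdist P x y ≤ C := by
  rcases Nat.eq_zero_or_pos d with hd | hd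
  · subst hd
    unfold tdist
    rw [Finset.univ_eq_empty, Finset.sup_empty]
    simpa using hC
  · obtain ⟨i, hi⟩ := exists_tdist_eq_circAbs hP hd x y
    rw [hi]; exact h i

variable {L : ℕ} [NeZero L] {m : Fin d → ℕ}

omit [NeZero L] in
/-- a fine coordinate is `L·(block coordinate) + offset` with `0 ≤ offset ≤ L − 1` (as integers). [cite: Balaban1985Averaging, (2) p.17] -/
theorem coord_eq_mul_blockCoord_add (hL : 1 ≤ L) (x : TSite d (fineP L m)) (i : Fin d) :
    ∃ r : ℤ, 0 ≤ r ∧ r ≤ (L : ℤ) - 1 ∧ ((x i).val : ℤ) = L * ((blockCoord L m x i).val : ℤ) + r := by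
  refine ⟨(((x i).val % L : ℕ) : ℤ), by positivity, ?_, ?_⟩
  · have := Nat.mod_lt (x i).val (by omega : 0 < L)
    omega
  · rw [blockCoord_apply_val]
    have h := Nat.div_add_mod (x i).val L
    exact_mod_cast h.symm

/-- **`L·d_m(π x, π x′) − (L − 1) ≤ d_{Lm}(x, x′)`** (`π = blockCoord`): the fine torus distance dominates `L` times the coarse distance of the blocks, up to
one block width. [folklore] [cite: Balaban1985Averaging, (2) p.17; Balaban1985BackgroundPropagators, (3.49) p.399 «d(y,y′) for x ∈ Δ(y), x′ ∈ Δ(y′)»] -/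
theorem mul_tdist_blockCoord_sub_le_tdist (hm : ∀ i, 1 ≤ m i) (x x' : TSite d (fineP L m)) :
    (L : ℝ) * tdist m (blockCoord L m x) (blockCoord L m x') - ((L : ℝ) - 1) ≤ tdist (fineP L m) x x' := by
  have hL : 1 ≤ L := Nat.one_le_iff_ne_zero.mpr (NeZero.ne L)
  have hP : ∀ i, 1 ≤ fineP L m i := fun i => Nat.one_le_iff_ne_zero.mpr (Nat.mul_ne_zero (by omega) (by have := hm i; omega))
  rcases Nat.eq_zero_or_pos d with hd | hd
  · subst hd
    have h0 : tdist m (blockCoord L m x) (blockCoord L m x') = 0 := by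
      unfold tdist; rw [Finset.univ_eq_empty, Finset.sup_empty]; simp
    rw [h0, mul_zero]
    have hL1 : (1 : ℝ) ≤ L := by exact_mod_cast hL
    linarith [tdist_nonneg (fineP L m) x x']
  · obtain ⟨i, hi⟩ := exists_tdist_eq_circAbs hm hd (blockCoord L m x) (blockCoord L m x')
    obtain ⟨r, hr0, hrL, hxr⟩ := coord_eq_mul_blockCoord_add hL x i
    obtain ⟨r', hr0', hrL', hxr'⟩ := coord_eq_mul_blockCoord_add hL x' i
    have h1 := mul_circAbs_sub_le_circAbs hL (hm i) ((blockCoord L m x i).val : ℤ) ((blockCoord L m x' i).val : ℤ) r r' hr0 hrL hr0' hrL'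
    rw [← hxr, ← hxr'] at h1
    have h2 := circAbs_le_tdist hP x x' i
    have h1' : (L : ℝ) * (circAbs (m i) (((blockCoord L m x i).val : ℤ) - ((blockCoord L m x' i).val : ℤ)) : ℝ) - ((L : ℝ) - 1) ≤
        (circAbs (fineP L m i) (((x i).val : ℤ) - ((x' i).val : ℤ)) : ℝ) := by exact_mod_cast h1
    rw [hi]
    linarith

/-- **`d_{Lm}(x, x′) ≤ L·d_m(π x, π x′) + (L − 1)`**. [folklore] [cite: Balaban1985Averaging, (2) p.17; Balaban1985BackgroundPropagators, (3.49) p.399] -/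
theorem tdist_le_mul_tdist_blockCoord_add (hm : ∀ i, 1 ≤ m i) (x x' : TSite d (fineP L m)) :
    tdist (fineP L m) x x' ≤ (L : ℝ) * tdist m (blockCoord L m x) (blockCoord L m x') + ((L : ℝ) - 1) := by
  have hL : 1 ≤ L := Nat.one_le_iff_ne_zero.mpr (NeZero.ne L)
  have hL1 : (1 : ℝ) ≤ L := by exact_mod_cast hL
  have hP : ∀ i, 1 ≤ fineP L m i := fun i => Nat.one_le_iff_ne_zero.mpr (Nat.mul_ne_zero (by omega) (by have := hm i; omega))
  refine tdist_le_of_forall_le hP x x' (by have := tdist_nonneg m (blockCoord L m x) (blockCoord L m x'); nlinarith) fun i => ?_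
  obtain ⟨r, hr0, hrL, hxr⟩ := coord_eq_mul_blockCoord_add hL x i
  obtain ⟨r', hr0', hrL', hxr'⟩ := coord_eq_mul_blockCoord_add hL x' i
  have h1 := circAbs_le_mul_circAbs_add hL (hm i) ((blockCoord L m x i).val : ℤ) ((blockCoord L m x' i).val : ℤ) r r' hr0 hrL hr0' hrL'
  rw [← hxr, ← hxr'] at h1
  have h2 := circAbs_le_tdist hm (blockCoord L m x) (blockCoord L m x') i
  have h1' : (circAbs (fineP L m i) (((x i).val : ℤ) - ((x' i).val : ℤ)) : ℝ) ≤
      (L : ℝ) * (circAbs (m i) (((blockCoord L m x i).val : ℤ) - ((blockCoord L m x' i).val : ℤ)) : ℝ) + ((L : ℝ) - 1) := by exact_mod_cast h1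
  nlinarith

/-- two sites of ONE block are within `L − 1`. [folklore] [cite: Balaban1985Averaging, (2) p.17] -/
theorem tdist_le_of_blockCoord_eq (hm : ∀ i, 1 ≤ m i) {x x' : TSite d (fineP L m)} (h : blockCoord L m x = blockCoord L m x') :
    tdist (fineP L m) x x' ≤ (L : ℝ) - 1 := by
  have h1 := tdist_le_mul_tdist_blockCoord_add hm x x'
  rw [h, tdist_self, mul_zero, zero_add] at h1
  exact h1

omit [NeZero L] in
/-- one lattice step has torus length `≤ 1`: `d(x, x + e_μ) ≤ 1`. [folklore] [cite: Balaban1985Averaging, (1)–(2) p.17] -/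
theorem tdist_shift_le_one {P : Fin d → ℕ} (hP : ∀ i, 1 ≤ P i) (x : TSite d P) (μ : Fin d) : tdist P x (shift μ x) ≤ 1 := by
  refine tdist_le_of_forall_le hP x (shift μ x) zero_le_one fun i => ?_
  by_cases hi : i = μ
  · subst hi
    exact circAbs_bond_le_one i (hP i) x
  · rw [shift_apply_ne hi, sub_self, circAbs_zero]
    simp

/-- **a bond has torus length `≤ 1`: `d(b₋, b₊) ≤ 1`**. [folklore] [cite: Balaban1985Averaging, (1)–(2) p.17; Balaban1985BackgroundPropagators, (3.3) p.390] -/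
theorem tdist_bpos_btgt_le_one {P : Fin d → ℕ} (hP : ∀ i, 1 ≤ P i) (b : Bond d P) : tdist P (bpos b) (btgt b) ≤ 1 :=
  tdist_shift_le_one hP b.1 b.2

end Torus

/-! ## §3 The set distance to a block -/

section SetDist

variable {d : ℕ} {L : ℕ} [NeZero L] {m : Fin d → ℕ}

omit [NeZero L] in
/-- on the block the distance to the block vanishes. [folklore] [cite: Balaban1985BackgroundPropagators, (3.49) p.399] -/
theorem tsetDist_blockOf_eq_zero {y₀ : TSite d m} {x : TSite d (fineP L m)} (hx : blockCoord L m x = y₀) :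
    tsetDist (fineP L m) x (B9Eq319QprimeTorus.blockOf L m y₀) = 0 :=
  le_antisymm ((tsetDist_le_of_mem (fineP L m) x ((mem_blockOf_iff L m y₀ x).mpr hx)).trans_eq (tdist_self _ x)) (tsetDist_nonneg _ _ _)

omit [NeZero L] in
/-- the distance to a set is 1-Lipschitz for the torus distance. [folklore] [cite: Balaban1985BackgroundPropagators, (3.49) p.399] -/
theorem abs_tsetDist_sub_le_tdist (hm : ∀ i, 1 ≤ m i) (hL : 1 ≤ L) (S : Finset (TSite d (fineP L m))) (x x' : TSite d (fineP L m)) :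
    |tsetDist (fineP L m) x S - tsetDist (fineP L m) x' S| ≤ tdist (fineP L m) x x' := by
  have hP : ∀ i, 1 ≤ fineP L m i := fun i => Nat.one_le_iff_ne_zero.mpr (Nat.mul_ne_zero (by omega) (by have := hm i; omega))
  have h1 := tsetDist_le_tdist_add hP x x' S
  have h2 := tsetDist_le_tdist_add hP x' x S
  rw [tdist_symm hP x' x] at h2
  rw [abs_le]; constructor <;> linarith

/-- **`L·d_m(y₀, π x) − (L − 1) ≤ dist(x, Δ(y₀))`**: a site of block `π x` is at least that far from every site of `Δ(y₀)`. [folklore]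
[cite: Balaban1985BackgroundPropagators, (3.49) p.399 «for x ∈ Δ(y), x′ ∈ Δ(y′)»; Balaban1985Averaging, (2) p.17] -/
theorem le_tsetDist_blockOf (hm : ∀ i, 1 ≤ m i) (y₀ : TSite d m) (x : TSite d (fineP L m)) :
    (L : ℝ) * tdist m y₀ (blockCoord L m x) - ((L : ℝ) - 1) ≤ tsetDist (fineP L m) x (B9Eq319QprimeTorus.blockOf L m y₀) := by
  have hne : (B9Eq319QprimeTorus.blockOf L m y₀).Nonempty := ⟨B9Eq319QprimeTorus.centre L m y₀, centre_mem_blockOf L m y₀⟩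
  unfold tsetDist
  rw [dif_pos hne, Finset.le_inf'_iff]
  intro a ha
  rw [mem_blockOf_iff] at ha
  have h := mul_tdist_blockCoord_sub_le_tdist hm x a
  rw [ha, tdist_symm hm (blockCoord L m x) y₀] at h
  exact h

end SetDist

/-! ## §4 The truncated weight `w = min(dist(·, Δ(y₀)), D)` -/

section Trunc

variable {d : ℕ} {L : ℕ} [NeZero L] {m : Fin d → ℕ}

/-- truncation is 1-Lipschitz: `|min a D − min b D| ≤ |a − b|` (private helper). [folklore] -/
private theorem abs_min_sub_min_le (a b D : ℝ) : |min a D - min b D| ≤ |a - b| :=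
  (abs_min_sub_min_le_max a D b D).trans_eq (by rw [sub_self, abs_zero, max_eq_left (abs_nonneg _)])

omit [NeZero L] in
/-- **`w ≡ 0` on the source block `Δ(y₀)`** (`0 ≤ D`). [folklore] [cite: Balaban1985BackgroundPropagators, (3.49) p.399] -/
theorem truncDist_eq_zero_of_mem {y₀ : TSite d m} {D : ℝ} (hD : 0 ≤ D) {x : TSite d (fineP L m)} (hx : blockCoord L m x = y₀) :
    min (tsetDist (fineP L m) x (B9Eq319QprimeTorus.blockOf L m y₀)) D = 0 := by
  rw [tsetDist_blockOf_eq_zero hx, min_eq_left hD]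

/-- **`w ≡ D` on the target block `Δ(y₁)`** for the truncation height `D = (L·d_m(y₀,y₁) − (L−1))₊`. [folklore]
[cite: Balaban1985BackgroundPropagators, (3.49) p.399 «e^{−δ₀d(y,y′)}»; Balaban1985Averaging, (2) p.17] -/
theorem truncDist_eq_of_mem (hm : ∀ i, 1 ≤ m i) (y₀ y₁ : TSite d m) {x : TSite d (fineP L m)} (hx : blockCoord L m x = y₁) :
    min (tsetDist (fineP L m) x (B9Eq319QprimeTorus.blockOf L m y₀)) (max 0 ((L : ℝ) * tdist m y₀ y₁ - ((L : ℝ) - 1))) =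
      max 0 ((L : ℝ) * tdist m y₀ y₁ - ((L : ℝ) - 1)) := by
  refine min_eq_right (max_le (tsetDist_nonneg _ _ _) ?_)
  have h := le_tsetDist_blockOf hm y₀ x
  rw [hx] at h
  exact h

omit [NeZero L] in
/-- the truncated weight is 1-Lipschitz for the fine torus distance. [folklore] [cite: Balaban1985BackgroundPropagators, (3.49) p.399, (3.101) p.414] -/
theorem abs_truncDist_sub_le_tdist (hm : ∀ i, 1 ≤ m i) (hL : 1 ≤ L) (S : Finset (TSite d (fineP L m))) (D : ℝ) (x x' : TSite d (fineP L m)) :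
    |min (tsetDist (fineP L m) x S) D - min (tsetDist (fineP L m) x' S) D| ≤ tdist (fineP L m) x x' :=
  (abs_min_sub_min_le _ _ D).trans (abs_tsetDist_sub_le_tdist hm hL S x x')

omit [NeZero L] in
/-- **bond increments of the truncated weight are `≤ 1`**. [folklore] [cite: Balaban1985BackgroundPropagators, (3.101) p.414 «(∂h)(Γ_{x,x′})», (3.49) p.399] -/
theorem abs_truncDist_bond_le_one (hm : ∀ i, 1 ≤ m i) (hL : 1 ≤ L) (S : Finset (TSite d (fineP L m))) (D : ℝ) (b : Bond d (fineP L m)) :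
    |min (tsetDist (fineP L m) (bpos b) S) D - min (tsetDist (fineP L m) (btgt b) S) D| ≤ 1 := by
  have hP : ∀ i, 1 ≤ fineP L m i := fun i => Nat.one_le_iff_ne_zero.mpr (Nat.mul_ne_zero (by omega) (by have := hm i; omega))
  exact (abs_truncDist_sub_le_tdist hm hL S D _ _).trans (tdist_bpos_btgt_le_one hP b)

/-- the truncated weight oscillates by `≤ L − 1` inside a block. [folklore] [cite: Balaban1985Averaging, (2) p.17; Balaban1985BackgroundPropagators, (3.49) p.399] -/
theorem abs_truncDist_sub_le_of_blockCoord_eq (hm : ∀ i, 1 ≤ m i) (S : Finset (TSite d (fineP L m))) (D : ℝ) {x x' : TSite d (fineP L m)}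
    (h : blockCoord L m x = blockCoord L m x') :
    |min (tsetDist (fineP L m) x S) D - min (tsetDist (fineP L m) x' S) D| ≤ (L : ℝ) - 1 :=
  (abs_truncDist_sub_le_tdist hm (Nat.one_le_iff_ne_zero.mpr (NeZero.ne L)) S D x x').trans (tdist_le_of_blockCoord_eq hm h)

omit [NeZero L] in
/-- the truncated weight is non-negative (`0 ≤ D`). [folklore] [cite: Balaban1985BackgroundPropagators, (3.49) p.399] -/
theorem truncDist_nonneg (S : Finset (TSite d (fineP L m))) {D : ℝ} (hD : 0 ≤ D) (x : TSite d (fineP L m)) :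
    0 ≤ min (tsetDist (fineP L m) x S) D :=
  le_min (tsetDist_nonneg _ _ _) hD

/-- the truncation height against the coarse distance: `d_m(y₀,y₁) − 1 ≤ D∕L ≤ d_m(y₀,y₁)`, `D = (L·d_m(y₀,y₁) − (L−1))₊`. [folklore]
[cite: Balaban1985BackgroundPropagators, (3.49) p.399 «e^{−δ₀d(y,y′)}»] -/
theorem height_div_bounds (y₀ y₁ : TSite d m) :
    tdist m y₀ y₁ - 1 ≤ max 0 ((L : ℝ) * tdist m y₀ y₁ - ((L : ℝ) - 1)) / L ∧
      max 0 ((L : ℝ) * tdist m y₀ y₁ - ((L : ℝ) - 1)) / L ≤ tdist m y₀ y₁ := by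
  have hL : (0 : ℝ) < L := by exact_mod_cast Nat.pos_of_ne_zero (NeZero.ne L)
  have hL1 : (1 : ℝ) ≤ L := by exact_mod_cast Nat.one_le_iff_ne_zero.mpr (NeZero.ne L)
  have ht := tdist_nonneg m y₀ y₁
  constructor
  · rw [le_div_iff₀ hL]
    refine le_trans ?_ (le_max_right _ _)
    nlinarith
  · rw [div_le_iff₀ hL]
    refine max_le (by nlinarith) ?_
    nlinarith

end Trunc

/-! ## §5 The package, in the letters of ne9-leaf-06's circle theorem and of (A) §2 -/

section Package

variable {d : ℕ} {L : ℕ} [NeZero L] {m : Fin d → ℕ}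

/-- **THE PAIR-ADAPTED WEIGHT.** For every pair of coarse sites `(y₀, y₁)` there is a real weight `χ` on the fine torus `T_{(L·m)}` with: `0 ≤ χ`;
`χ ≡ 0` on the block `Δ(y₀)` and `χ ≡ D∕L` on `Δ(y₁)` ((K1)'s eigen-relations ⇒ (A) §2's `hp`∕`hq` with `a = 0`, `b = D∕L`); bond increments
`|χ(b₋) − χ(b₊)| ≤ 1∕L` (ne9-leaf-06's `hχ` with `ℓ := (Lη)⁻¹`); in-block oscillation `|χ x − χ x′| ≤ 1` (their `hω` with `ω = 1`) and the coarse reading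
at the centres `|χ(L·y) − χ x| ≤ 1` on `Δ(y)` (their `hχ′` with `χ′ y := χ(L·y)`, `ℓ′ = 1`); and the height obeys `d_m(y₀,y₁) − 1 ≤ D∕L ≤ d_m(y₀,y₁)` —
so ONE conjugation bound `C(r)` at `κ = ±r` yields the block entry `‖q_{y₁}Tp_{y₀}‖ ≤ C(r)e^{r}·e^{−r·d_m(y₀,y₁)}`. [folklore]
[cite: Balaban1985BackgroundPropagators, (3.49) p.399 «e^{−δ₀d(y,y′)} for x ∈ Δ(y), x′ ∈ Δ(y′)», (3.101) p.414; Balaban1985Averaging, (2) p.17] -/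
theorem exists_pairWeight (hm : ∀ i, 1 ≤ m i) (y₀ y₁ : TSite d m) :
    ∃ χ : TSite d (fineP L m) → ℝ,
      (∀ x, 0 ≤ χ x) ∧
      (∀ x, blockCoord L m x = y₀ → χ x = 0) ∧
      (∀ x, blockCoord L m x = y₁ → χ x = max 0 ((L : ℝ) * tdist m y₀ y₁ - ((L : ℝ) - 1)) / L) ∧
      (∀ b : Bond d (fineP L m), |χ (bpos b) - χ (btgt b)| ≤ 1 / (L : ℝ)) ∧
      (∀ x x', blockCoord L m x = blockCoord L m x' → |χ x - χ x'| ≤ 1) ∧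
      (∀ (y : TSite d m), ∀ x ∈ B9Eq319QprimeTorus.blockOf L m y, |χ (B9Eq319QprimeTorus.centre L m y) - χ x| ≤ 1) ∧
      tdist m y₀ y₁ - 1 ≤ max 0 ((L : ℝ) * tdist m y₀ y₁ - ((L : ℝ) - 1)) / L ∧
      max 0 ((L : ℝ) * tdist m y₀ y₁ - ((L : ℝ) - 1)) / L ≤ tdist m y₀ y₁ := by
  have hL : 1 ≤ L := Nat.one_le_iff_ne_zero.mpr (NeZero.ne L)
  have hLpos : (0 : ℝ) < L := by exact_mod_cast (show 0 < L by omega)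
  have hL1 : (1 : ℝ) ≤ L := by exact_mod_cast hL
  set D : ℝ := max 0 ((L : ℝ) * tdist m y₀ y₁ - ((L : ℝ) - 1)) with hD
  have hD0 : 0 ≤ D := le_max_left _ _
  set S := B9Eq319QprimeTorus.blockOf L m y₀ with hS
  refine ⟨fun x => min (tsetDist (fineP L m) x S) D / L, fun x => div_nonneg (truncDist_nonneg S hD0 x) hLpos.le,
    fun x hx => by beta_reduce; rw [truncDist_eq_zero_of_mem hD0 hx, zero_div],
    fun x hx => by beta_reduce; rw [hS, hD, truncDist_eq_of_mem hm y₀ y₁ hx],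
    fun b => ?_, fun x x' h => ?_, fun y x hx => ?_, (height_div_bounds y₀ y₁).1, (height_div_bounds y₀ y₁).2⟩
  · rw [← sub_div, abs_div, abs_of_pos hLpos]
    exact div_le_div_of_nonneg_right (abs_truncDist_bond_le_one hm hL S D b) hLpos.le
  · rw [← sub_div, abs_div, abs_of_pos hLpos, div_le_one hLpos]
    exact (abs_truncDist_sub_le_of_blockCoord_eq hm S D h).trans (by linarith)
  · rw [← sub_div, abs_div, abs_of_pos hLpos, div_le_one hLpos]
    have h : blockCoord L m (B9Eq319QprimeTorus.centre L m y) = blockCoord L m x := by rw [blockCoord_centre, (mem_blockOf_iff L m y x).mp hx]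
    exact (abs_truncDist_sub_le_of_blockCoord_eq hm S D h).trans (by linarith)

end Package

/-! ## §6 Non-vacuity -/

/-- §1 at `L = 2`, `m = 3`, blocks `q = 0`, `q′ = 1`, offsets `r = 1`, `r′ = 0`: `2·dist(−1, 3ℤ) − 1 = 1 ≤ dist(−1, 6ℤ) = 1`. [folklore] -/
example : (2 : ℤ) * circAbs 3 (0 - 1) - ((2 : ℤ) - 1) ≤ circAbs (2 * 3) (2 * 0 + 1 - (2 * 1 + 0)) :=
  mul_circAbs_sub_le_circAbs (L := 2) (m := 3) (by norm_num) (by norm_num) 0 1 1 0 (by norm_num) (by norm_num) (by norm_num) (by norm_num)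

end Literature.MathematicalPhysics.QuantumFieldTheory.Balaban1983to89.B9Eq349BlockDistanceWeight

end
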